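import Summits.QuantumFields.BalabanUV.Beta.GAN24.ContactBorderEntryBoundTwo

/-!
# `BalabanUV.Beta.GAN24.ContactBorderEntryBoundTwoMf` — binder row G-an2-4 / (CONV-C), CT-ROUTE, «(V-C)-DIFF» (the CONTACT V PAIR letter of the born-V rate half), module (A′):
# **THE TWO-TOWER ENTRY BOUND OF THE mf-CHANNEL V CELLS** (generic `d`) — (B3) `ContactBorderEntryBoundMf.abs_contact_border_mf_le` with the RIGHT-slot pair `(T_r, B_r, λ_r)` and the
# TABLE-slot pair `(T_w, B_w, λ_w)` from DIFFERENT towers with DIFFERENT letters; the diagonal case is (B3)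

NOT IN PRINT; OUR BOOKKEEPING (G-an2-4 formalisation swarm → CRUX TEAM (2), leaf prover `b2b-balaban-gan24-formalise-leaf-03`, gen 56; «(V-C)-DIFF» INTENT journal `CLAIMS.log`
[LEAF03-G56-ONLINE]).  [folklore] bookkeeping over leaf-02 g48's `ContactBorderCommutator.contact_border_mf_eq_factorised` (independent right and table pairs), (B2)
`ContactBorderEntryBound` (TIP ∕ ROOT cell sums, sublattice re-indexing), (A) `ContactBorderEntryBoundTwo.abs_sum_tsum_tip_dz_le₂` (two-amplitude TIP × GRADIENT cell), leaf-01 g60's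
`ContactFaceJumpBorder.tipCommutator_eq_sum` BY NAME.  Generic `d`; every analytic input a LETTER; 0 `def`, 0 cited facts, 0 `def … : Prop`, 0 sorry; NO estimate of Bałaban's.
HONEST FRAMING (cell contract, verbatim): «discharging `BetaPertH` makes Bałaban's UV stability UNCONDITIONAL — a real constructive-QFT result; it is NOT the continuum limit and NOT the
Clay problem.»  HONEST DEPENDENCY (verbatim): «continuum YM on T⁴ ⇐ BetaPertH ∧ nine spine estimates (0/9 proved); BetaPertH ⇐ (D1) ∧ (D4) ∧ CAP+tail; G-an2-4 gates asym, D1 and NE2/3/4.»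

## What (generic `d`, `1 ≤ Lc`, box root `ρ = toSite rr`; ONE rate `κ`; `E₀ = e^{2(d+1)κ}`, `Cnt = (2Lc)^{d+1}·((d+1)·(Lc^{d+1}·ell))`, `A(α) = 2α + 2α·Lc·n`, `P(a,b) = 4ab + 2(4ab)·Lc·n`)
**`abs_contact_border_mf_le₂`**: right pair `(T_r, B_r, λ_r)` (letters `C_r, K_r, α_r`), table pair `(T_w, B_w, λ_w)` (letters `C_w, K_w, α_w`), multiplier LEFT leg `M` (bounded, summable,
tent `T_b` centred at its output label `x′`):
`|push₃ M T_r T_w S′ − push₃ M B_r B_w S′| (mf entries) ≤ (Lc^{d+1})⁻¹·((d+1)·T_b·(E₀²·Cnt))·(K_w·A(α_r) + P(α_r,α_w) + K_r·A(α_w))·((Lc^n)^{d+1}·Zl(κ∕(4(d+1))))·e^{−(κ∕12)(‖z′−x′‖∞+‖u′−x′‖∞)}`.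
NOT HERE: the pair telescoping ((B) `ContactBorderPairEntryBound`), the `d = 3` letters and the unit count ((C) ∕ (D)).  Discharges NO letter of (CONV-C); hBdev ∕ (hS, hSall) OPEN;
NEVER «G-an2-4 closed» as (CONV-C); NOT D1, NOT BetaPertH, NOT continuum, NOT Clay.  Unit `b2b-balaban-gan24-formalise-leaf-03` (gen 56), 2026-08-21.
-/

noncomputable section

open Finset
open scoped BigOperators
open Literature.MathematicalPhysics.QuantumFieldTheory
open Literature.MathematicalPhysics.QuantumFieldTheory.LatticeForm (quo)
open Literature.MathematicalPhysics.QuantumFieldTheory.Balaban1983to89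
open Literature.MathematicalPhysics.QuantumFieldTheory.Balaban1983to89.Beta
open B4ContourShift (supNorm supNorm_nonneg)
open ExpKernelCalculus (MKer Zl Zl_nonneg)
open AffineAveraging (Form0 Form1 Site box toSite unitVec dz)
open AveragingContours (blk off)
open AveragingContoursRooted (linAvgAt)
open AveragingHessianKernels (ell)
open AveragingHessianKernelsRooted (linCountAt vhSAt)
open OneStepResolventKernel (Fib)
open Summit.QuantumFields.BalabanUV.Beta.GAN24.SrecLinearPartEq (reslot)
open Summit.QuantumFields.BalabanUV.Beta.GAN24.Push3 (push₃)
open Summit.QuantumFields.BalabanUV.Beta.GAN24.Push3LegTelescope (abs_le_of_env' summable_of_env')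
open Summit.QuantumFields.BalabanUV.Beta.GAN24.ContactFaceJumpBorder (tipCommutator_eq_sum)
open Summit.QuantumFields.BalabanUV.Beta.GAN24.ContactBorderCommutator (contact_border_mf_eq_factorised)
open Summit.QuantumFields.BalabanUV.Beta.GAN24.ContactBorderEntryBound (tsum_sum_mul_ite_off_eq abs_sum_tsum_tip_le abs_sum_tsum_root_le)
open Summit.QuantumFields.BalabanUV.Beta.GAN24.ContactBorderEntryBoundTwo (abs_sum_tsum_tip_dz_le₂)

namespace Summit.QuantumFields.BalabanUV.Beta.GAN24.ContactBorderEntryBoundTwoMf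

variable {d : ℕ} {Lc : ℕ} {rr : Fin (d + 1) → ℕ}

section Mf

variable [NeZero Lc] {n : ℕ} {κ αr αw KBr KBw CTr CTw CM Tb : ℝ}
  {Tr Br Tw Bw M : Fin (d + 1) → (Fin (d + 1) → ℤ) → Fin (d + 1) → (Fin (d + 1) → ℤ) → ℝ}
  {lamr lamw : Fin (d + 1) → (Fin (d + 1) → ℤ) → (Fin (d + 1) → ℤ) → ℝ}
  {Gr Gw : Fin (d + 1) → (Fin (d + 1) → ℤ) → ℕ → Site (d + 1) → ℝ}

/-- NOT IN PRINT; OUR BOOKKEEPING ([folklore]; every analytic input a LETTER).  **THE TWO-TOWER ENTRY BOUND OF THE mf-CHANNEL V CELLS.**  RIGHT pair `(T_r, B_r)` (letters `K_r, α_r`;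
`T_r − B_r = dz λ_r`), TABLE pair `(T_w, B_w)` (letters `K_w, α_w`; `T_w − B_w = dz λ_w`), the multiplier LEFT leg `M` bounded with summable fine slices under the TENT letter
`|M α x′ μ (Lc•y)| ≤ T_b·e^{−κ‖quo (Lc^n) y − x′‖∞}`.  THEN for all `κ′ u′ x′ z′ α β`, with `V_ρ = vhSAt ρ d Lc`,
`|push₃ M T_r T_w (reslot inr inl V_ρ) κ′u′ x′z′ (inl α)(inl β) − push₃ M B_r B_w (reslot inr inl V_ρ) κ′u′ x′z′ (inl α)(inl β)|`
`≤ (Lc^{d+1})⁻¹·((d+1)·T_b·(E₀²·Cnt))·(K_w·A(α_r) + P(α_r,α_w) + K_r·A(α_w))·((Lc^n)^{d+1}·Zl(κ∕(4(d+1))))·e^{−(κ∕12)(‖z′−x′‖∞ + ‖u′−x′‖∞)}`. -/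
theorem abs_contact_border_mf_le₂ (hLc : 1 ≤ Lc) (hrr : rr ∈ box (d + 1) Lc) (hκ : 0 < κ) (hαr : 0 ≤ αr) (hαw : 0 ≤ αw) (hKBr : 0 ≤ KBr)
    (hKBw : 0 ≤ KBw) (hTb : 0 ≤ Tb)
    (hTr : ∀ μ z κ u, |Tr μ z κ u| ≤ CTr) (hTrs : ∀ μ z κ, Summable fun u => Tr μ z κ u)
    (hBr : ∀ μ z l u, |Br μ z l u| ≤ KBr * Real.exp (-(κ * supNorm (quo (Lc ^ (n + 1)) u - z))))
    (hTBr : Tr - Br = fun μ z κ u => dz (lamr μ z) κ u)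
    (hψr : ∀ μ₀ z₀ u, lamr μ₀ z₀ u = ∑ s ∈ Finset.range (n + 1), Gr μ₀ z₀ s (blk (Lc ^ s) u))
    (hGr : ∀ μ₀ z₀ s, s ≤ n → ∀ u, |Gr μ₀ z₀ s (blk (Lc ^ s) u)| ≤ αr * (Lc : ℝ) ^ s * Real.exp (-(κ * supNorm (quo (Lc ^ (n + 1)) u - z₀))))
    (hTw : ∀ μ z κ u, |Tw μ z κ u| ≤ CTw)
    (hBw : ∀ μ z l u, |Bw μ z l u| ≤ KBw * Real.exp (-(κ * supNorm (quo (Lc ^ (n + 1)) u - z))))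
    (hTBw : Tw - Bw = fun μ z κ u => dz (lamw μ z) κ u)
    (hψw : ∀ μ₀ z₀ u, lamw μ₀ z₀ u = ∑ s ∈ Finset.range (n + 1), Gw μ₀ z₀ s (blk (Lc ^ s) u))
    (hGw : ∀ μ₀ z₀ s, s ≤ n → ∀ u, |Gw μ₀ z₀ s (blk (Lc ^ s) u)| ≤ αw * (Lc : ℝ) ^ s * Real.exp (-(κ * supNorm (quo (Lc ^ (n + 1)) u - z₀))))
    (hM : ∀ α x' μ x, |M α x' μ x| ≤ CM) (hMs : ∀ α x' μ, Summable fun x => M α x' μ x)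
    (hMt : ∀ (α : Fin (d + 1)) (x' : Site (d + 1)) (μ : Fin (d + 1)) (y : Site (d + 1)),
      |M α x' μ ((Lc : ℤ) • y)| ≤ Tb * Real.exp (-(κ * supNorm (quo (Lc ^ n) y - x'))))
    (κ' : Fin (d + 1)) (u' x' z' : Site (d + 1)) (α β : Fin (d + 1)) :
    |push₃ M Tr Tw (reslot Sum.inr Sum.inl (vhSAt (toSite rr) d Lc rfl)) κ' u' x' z' (Sum.inl α) (Sum.inl β)
        - push₃ M Br Bw (reslot Sum.inr Sum.inl (vhSAt (toSite rr) d Lc rfl)) κ' u' x' z' (Sum.inl α) (Sum.inl β)|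
      ≤ ((Lc : ℝ) ^ (d + 1))⁻¹ *
          ((((d : ℝ) + 1) * Tb * (Real.exp (2 * ((d : ℝ) + 1) * κ) ^ 2 *
              (((2 * Lc : ℕ) : ℝ) ^ (d + 1) * (((d + 1 : ℕ) : ℝ) * ((Lc : ℝ) ^ (d + 1) * (ell (d + 1) Lc : ℝ))))))
            * (KBw * (2 * αr + 2 * αr * Lc * n) + (4 * (αr * αw) + 2 * (4 * (αr * αw)) * Lc * n) + KBr * (2 * αw + 2 * αw * Lc * n))
            * ((((Lc ^ n : ℕ) : ℝ)) ^ (d + 1) * Zl (d + 1) (κ / (4 * ((d : ℝ) + 1))))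
            * Real.exp (-(κ / 12) * (supNorm (z' - x') + supNorm (u' - x')))) := by
  -- the leg classes of `B_r`, `B_w` and the socket
  have hLn1 : 1 ≤ Lc ^ (n + 1) := Nat.one_le_pow _ _ hLc
  have hBrb : ∀ μ z l u, |Br μ z l u| ≤ KBr := abs_le_of_env' hκ.le hBr
  have hBrs : ∀ μ z l, Summable fun u => Br μ z l u := summable_of_env' hLn1 hκ hBr
  have hBwb : ∀ μ z l u, |Bw μ z l u| ≤ KBw := abs_le_of_env' hκ.le hBw
  rw [contact_border_mf_eq_factorised hLc hrr hM hMs hTr hTrs hBrb hBrs hTw hBwb hTBr hTBw κ' u' x' z' α β]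
  -- sublattice re-indexing of the two cells
  rw [tsum_sum_mul_ite_off_eq hLc (fun a x => M α x' a x) (fun a y x => ((Lc : ℝ) ^ (d + 1))⁻¹ *
      (linAvgAt (toSite rr) (fun κ u => lamr β z' (u + unitVec κ) * Tw κ' u' κ u) Lc a y
        - lamr β z' (x + toSite rr + (Lc : ℤ) • unitVec a) * linAvgAt (toSite rr) (Tw κ' u') Lc a y)),
    tsum_sum_mul_ite_off_eq hLc (fun a x => M α x' a x) (fun a y x => ((Lc : ℝ) ^ (d + 1))⁻¹ *
      (lamw κ' u' (x + toSite rr) * linAvgAt (toSite rr) (Br β z') Lc a y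
        - linAvgAt (toSite rr) (fun b z => lamw κ' u' z * Br β z' b z) Lc a y))]
  -- the split of the TIP cell's dressed table leg `T_w κ′ u′ = B_w κ′ u′ + dz (λ_w κ′ u′)`
  have eT : ∀ b z, Tw κ' u' b z = Bw κ' u' b z + dz (lamw κ' u') b z := fun b z => by
    have h := congrFun (congrFun (congrFun (congrFun hTBw κ') u') b) z
    simp only [Pi.sub_apply] at h
    linarith
  have hsplit : ∀ a y,
      linAvgAt (toSite rr) (fun b z => lamr β z' (z + unitVec b) * Tw κ' u' b z) Lc a y
          - lamr β z' ((Lc : ℤ) • y + toSite rr + (Lc : ℤ) • unitVec a) * linAvgAt (toSite rr) (Tw κ' u') Lc a y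
        = (linAvgAt (toSite rr) (fun b z => lamr β z' (z + unitVec b) * Bw κ' u' b z) Lc a y
            - lamr β z' ((Lc : ℤ) • y + toSite rr + (Lc : ℤ) • unitVec a) * linAvgAt (toSite rr) (Bw κ' u') Lc a y)
          + (linAvgAt (toSite rr) (fun b z => lamr β z' (z + unitVec b) * dz (lamw κ' u') b z) Lc a y
            - lamr β z' ((Lc : ℤ) • y + toSite rr + (Lc : ℤ) • unitVec a) * linAvgAt (toSite rr) (dz (lamw κ' u')) Lc a y) := by
    intro a y
    rw [tipCommutator_eq_sum hrr, tipCommutator_eq_sum hrr, tipCommutator_eq_sum hrr (lamr β z') (dz (lamw κ' u')), ← Finset.sum_add_distrib]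
    refine Finset.sum_congr rfl fun x _ => ?_
    rw [← Finset.sum_add_distrib]
    refine Finset.sum_congr rfl fun b _ => ?_
    rw [eT b x]; ring
  -- the three cells (brackets `b a y := M α x′ a (Lc•y)`, tent label `x′`)
  obtain ⟨hs1, hb1⟩ := abs_sum_tsum_tip_le (b := fun a y => M α x' a ((Lc : ℤ) • y)) (xg := z') (xl := u') (u' := x')
    hLc hrr hκ hαr hKBw hTb (hψr β z') (hGr β z') (fun b z => hBw κ' u' b z) (hMt α x')
  obtain ⟨hs2, hb2⟩ := abs_sum_tsum_tip_dz_le₂ (b := fun a y => M α x' a ((Lc : ℤ) • y)) (xg := z') (xl := u') (u' := x')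
    hLc hrr hκ hαr hαw hTb (hψr β z') (hψw κ' u') (hGr β z') (hGw κ' u') (hMt α x')
  obtain ⟨hs3, hb3⟩ := abs_sum_tsum_root_le (b := fun a y => M α x' a ((Lc : ℤ) • y)) (xg := u') (xl := z') (u' := x')
    hLc hrr hκ hαw hKBr hTb (hψw κ' u') (hGw κ' u') (fun b z => hBr β z' b z) (hMt α x')
  rw [add_comm (supNorm (u' - x')) (supNorm (z' - x'))] at hb3
  -- regroup the first cell: constant out, split, exchange
  set c₀ : ℝ := ((Lc : ℝ) ^ (d + 1))⁻¹ with hc₀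
  have e1 : (∑' y : Site (d + 1), ∑ a, M α x' a ((Lc : ℤ) • y) * (c₀ *
        (linAvgAt (toSite rr) (fun κ u => lamr β z' (u + unitVec κ) * Tw κ' u' κ u) Lc a y
          - lamr β z' ((Lc : ℤ) • y + toSite rr + (Lc : ℤ) • unitVec a) * linAvgAt (toSite rr) (Tw κ' u') Lc a y)))
      = c₀ * ((∑ a, ∑' y : Site (d + 1), M α x' a ((Lc : ℤ) • y) *
          (linAvgAt (toSite rr) (fun b z => lamr β z' (z + unitVec b) * Bw κ' u' b z) Lc a y
            - lamr β z' ((Lc : ℤ) • y + toSite rr + (Lc : ℤ) • unitVec a) * linAvgAt (toSite rr) (Bw κ' u') Lc a y))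
        + ∑ a, ∑' y : Site (d + 1), M α x' a ((Lc : ℤ) • y) *
          (linAvgAt (toSite rr) (fun b z => lamr β z' (z + unitVec b) * dz (lamw κ' u') b z) Lc a y
            - lamr β z' ((Lc : ℤ) • y + toSite rr + (Lc : ℤ) • unitVec a) * linAvgAt (toSite rr) (dz (lamw κ' u')) Lc a y)) := by
    have step1 : ∀ y : Site (d + 1), (∑ a, M α x' a ((Lc : ℤ) • y) * (c₀ *
        (linAvgAt (toSite rr) (fun κ u => lamr β z' (u + unitVec κ) * Tw κ' u' κ u) Lc a y
          - lamr β z' ((Lc : ℤ) • y + toSite rr + (Lc : ℤ) • unitVec a) * linAvgAt (toSite rr) (Tw κ' u') Lc a y)))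
        = c₀ * ∑ a, (M α x' a ((Lc : ℤ) • y) *
            (linAvgAt (toSite rr) (fun b z => lamr β z' (z + unitVec b) * Bw κ' u' b z) Lc a y
              - lamr β z' ((Lc : ℤ) • y + toSite rr + (Lc : ℤ) • unitVec a) * linAvgAt (toSite rr) (Bw κ' u') Lc a y)
          + M α x' a ((Lc : ℤ) • y) *
            (linAvgAt (toSite rr) (fun b z => lamr β z' (z + unitVec b) * dz (lamw κ' u') b z) Lc a y
              - lamr β z' ((Lc : ℤ) • y + toSite rr + (Lc : ℤ) • unitVec a) * linAvgAt (toSite rr) (dz (lamw κ' u')) Lc a y)) := by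
      intro y
      rw [Finset.mul_sum]
      refine Finset.sum_congr rfl fun a _ => ?_
      rw [hsplit a y]; ring
    rw [tsum_congr step1, tsum_mul_left, Summable.tsum_finsetSum (fun a _ => (hs1 a).add (hs2 a))]
    congr 1
    rw [← Finset.sum_add_distrib]
    exact Finset.sum_congr rfl fun a _ => (hs1 a).tsum_add (hs2 a)
  have e2 : (∑' y : Site (d + 1), ∑ a, M α x' a ((Lc : ℤ) • y) * (c₀ *
        (lamw κ' u' ((Lc : ℤ) • y + toSite rr) * linAvgAt (toSite rr) (Br β z') Lc a y
          - linAvgAt (toSite rr) (fun b z => lamw κ' u' z * Br β z' b z) Lc a y)))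
      = c₀ * ∑ a, ∑' y : Site (d + 1), M α x' a ((Lc : ℤ) • y) *
          (lamw κ' u' ((Lc : ℤ) • y + toSite rr) * linAvgAt (toSite rr) (Br β z') Lc a y
            - linAvgAt (toSite rr) (fun b z => lamw κ' u' z * Br β z' b z) Lc a y) := by
    rw [← Summable.tsum_finsetSum (fun a _ => hs3 a), ← tsum_mul_left]
    refine tsum_congr fun y => ?_
    rw [Finset.mul_sum]
    exact Finset.sum_congr rfl fun a _ => by ring
  rw [e1, e2, ← mul_add]
  have hc0 : 0 ≤ c₀ := by positivity
  rw [abs_mul, abs_of_nonneg hc0]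
  refine (mul_le_mul_of_nonneg_left ((abs_add_le _ _).trans (add_le_add ((abs_add_le _ _).trans (add_le_add hb1 hb2)) hb3)) hc0).trans
    (le_of_eq ?_)
  ring

end Mf

end Summit.QuantumFields.BalabanUV.Beta.GAN24.ContactBorderEntryBoundTwoMf

end
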